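import Literature.Algebra.EuclideanDomain.EuclideanOrderTypeSmallRings
import Literature.Algebra.EuclideanDomain.LengthVersusEuclideanFunction
import Literature.Algebra.EuclideanDomain.MinimalEuclideanFunctionPolynomial
import HarnessLib

/-!
# The Euclidean order type of `k[t]` is `ω`, of `k[t]/(tⁿ)` is `n`, and `e(k[t]ʳ × k[t]/(tⁿ)) = rω + n`
# (Clark 2015, Example 2.6 and Thm. 27 (b))

Topic `Literature/Algebra/EuclideanDomain`, namespace `Literature.Algebra.EuclideanDomain`.  THEOREMS ONLY (no `def`, no
instance, no named fact), all proved, in the vocabulary of `TransfiniteSmallestAlgorithm.lean` (`samuelSet R α = A_α`,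
`samuelRank = θ`, Clark's bottom Euclidean function is `φ_R = θ − 1` off `0`) and `EuclideanOrderTypeIndecomposable.lean`
(`e(R) = ⨆ z, ((θ z − 1) + 1)`).  Clark's own witnesses for Thm. 27 (b) — the rings `ℂ[t]ʳ × ℂ[t]/(tⁿ)` — are treated here for
an arbitrary field `k` (`EuclideanOrderTypeSmallRings.lean` realised the order types `ω·r + n` with `ℤ` and `ℤ/2ⁿℤ` instead).

## Source (read at the page)

P. L. Clark, *A note on Euclidean order types*, Order **32** (2015) [Clark2015EuclideanOrderTypes] (materialised
`paper:arxiv-1208.0977`, p0005 and p0007), VERBATIM.  «**Example 2.6:** Let `R = k[t]`. The map `x ∈ k[t] ↦ 1 + deg t` is the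
bottom Euclidean function, so `e(k[t]) = ω`.»  «**Theorem 27.** … b) For every ordinal `α < ω²`, there is a small Euclidean ring
`R` with `e(R) = α.  Proof. … b) The ordinals less than `ω²` are of the form `rω + n` for `r, n ∈ ω`. By part a),
`e(ℂ[t]ʳ × ℂ[t]/(tⁿ)) = rω + n`.»  (Samuel 1971 §4 Example (2), p. 290: «the smallest algorithm `θ` on `k[X]` is the usual
algorithm `θ(φ) = 1 + d°(φ)`» — `MinimalEuclideanFunctionPolynomial.lean`, in Motzkin's finite indexing.)

## What is formalised

* §1 **Example 2.6**: `Polynomial.samuelRank_eq` (`θ(f) = d°f + 1` for `f ≠ 0`, transfinite indexing; Clark's `φ_R(f) = deg f`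
  since his bottom function vanishes on units), `Polynomial.samuelSet_natCast_eq` (`A_n = {0} ∪ {d° < n}`),
  **`Polynomial.iSup_samuelRank_eq_omega0`** (`e(k[t]) = ω`).
* §2 `k[t]/(tⁿ)`: `Polynomial.length_quotient_span_X_pow` (`ℓ_{k[t]}(k[t]/(tⁿ)) = n`, `n` prime factors `t`),
  `Polynomial.length_self_quotient_span_X_pow` (its length as a ring), **`Polynomial.iSup_samuelRank_quotient_span_X_pow`**
  (`e(k[t]/(tⁿ)) = n` for `n ≥ 1`, by Cor. 24 `e = ℓ` for Artinian principal ideal rings).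
* §3 **Thm. 27 (b) as printed: `e(k[t]ʳ × k[t]/(tⁿ)) = ω·r + n`** (`r, n ≥ 1`; `Polynomial.iSup_samuelRank_pi_prod_quotient` for any
  finite index type in the universe of `k`, `Polynomial.iSup_samuelRank_fin_pi_prod_quotient` with `Fin r` for `k : Type`), and
  `e(k[t]ʳ) = ω·r` (`Polynomial.iSup_samuelRank_pi`, `Polynomial.iSup_samuelRank_fin_pi`).

## Mathlib / tree search

Mathlib: `Polynomial.prime_X`, `Polynomial.not_isUnit_X`, `Ideal.span_singleton_pow`, `Multiset.prod_replicate`, `isUnit_pow_iff`,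
`Module.length_eq_of_surjective`.  Tree: `Polynomial.forall_exists_not_mem_motzkinSet`, `Polynomial.motzkinRank_eq`,
`Polynomial.motzkinSet_eq` (`MinimalEuclideanFunctionPolynomial.lean`), `samuelRank_eq_natCast_motzkinRank`, `samuelSet_natCast`
(`TransfiniteSmallestAlgorithm.lean`), `forall_samuelRank_lt_omega0_iff_iSup_le`, `omega0_le_iSup_samuelRank_of_not_isUnit`,
`forall_exists_mem_samuelSet_of_euclideanDomain`, `exists_iSup_samuelRank_eq_and_length_eq` (Cor. 24),
`length_quotient_span_unit_mul_multiset_prod` (`LengthVersusEuclideanFunction.lean`), `Pi.iSup_samuelRank_eq_omega0_mul_card`,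
`iSup_samuelRank_pi_prod_eq` (`EuclideanOrderTypeSmallRings.lean`), `isArtinianRing_quotient_pow`, `isPrincipalIdealRing_quotient`
(`StructureOfPrincipalIdealRings.lean`); `rg "iSup_samuelRank" … Polynomial` → nothing before this file.
-/

open Polynomial

namespace Literature.Algebra.EuclideanDomain

open Ordinal Literature.RingTheory.PrincipalIdealRing

universe u

variable {K : Type u} [Field K]

/-! ## §1 Example 2.6: `e(k[t]) = ω` -/

section OrderType

/-- Samuel's smallest algorithm on `k[t]` in the transfinite indexing: **`θ(f) = d°f + 1`** for `f ≠ 0` (Clark, Example 2.6,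
verbatim: «The map `x ∈ k[t] ↦ 1 + deg t` is the bottom Euclidean function» [sic: `1 + deg x`]; Samuel: «the smallest algorithm `θ`
on `k[X]` is the usual algorithm `θ(φ) = 1 + d°(φ)`»).
[cite: Clark2015EuclideanOrderTypes, Example 2.6; Samuel1971, §4 Example (2) (p. 290)] -/
theorem Polynomial.samuelRank_eq {f : K[X]} (hf : f ≠ 0) :
    samuelRank f = ((f.natDegree + 1 : ℕ) : Ordinal.{u}) := by
  rw [samuelRank_eq_natCast_motzkinRank Polynomial.forall_exists_not_mem_motzkinSet, Polynomial.motzkinRank_eq hf]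

/-- The finite stages of the construction of `k[t]`: `A_n = {0} ∪ {f | d°f < n}` (the polynomials of degree `< n`, and `0`).
[cite: Clark2015EuclideanOrderTypes, Example 2.6; Samuel1971, §4 Example (2) (p. 290)] -/
theorem Polynomial.samuelSet_natCast_eq (n : ℕ) :
    samuelSet K[X] (n : Ordinal.{u}) = {f : K[X] | f = 0 ∨ f.natDegree < n} := by
  rw [samuelSet_natCast, Polynomial.motzkinSet_eq]
  ext f
  simp only [Set.mem_compl_iff, Set.mem_setOf_eq, not_and, not_le]
  tauto

/-- Every polynomial lies in a finite stage: `f ∈ A_{d°f + 1}`. [cite: Clark2015EuclideanOrderTypes, Example 2.6] -/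
theorem Polynomial.mem_samuelSet_natDegree_succ (f : K[X]) :
    f ∈ samuelSet K[X] ((f.natDegree + 1 : ℕ) : Ordinal.{u}) := by
  rw [Polynomial.samuelSet_natCast_eq]
  exact Or.inr (Nat.lt_succ_self _)

/-- **Example 2.6 «`e(k[t]) = ω`»**: all `θ(f) = d°f + 1` are finite, and `t` is a non-unit of the domain `k[t]`.
[cite: Clark2015EuclideanOrderTypes, Example 2.6] -/
theorem Polynomial.iSup_samuelRank_eq_omega0 : (⨆ f : K[X], (samuelRank f - 1 + 1)) = ω := by
  refine le_antisymm (forall_samuelRank_lt_omega0_iff_iSup_le.1 fun f ↦ ?_)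
    (omega0_le_iSup_samuelRank_of_not_isUnit forall_exists_mem_samuelSet_of_euclideanDomain Polynomial.X_ne_zero
      Polynomial.not_isUnit_X)
  exact (samuelRank_le_of_mem (Polynomial.mem_samuelSet_natDegree_succ f)).trans_lt (natCast_lt_omega0 _)

/-- Hence `e(k[t]^ι) = ω·|ι|` for a finite non-empty index type `ι`: `k[t]` is small. [cite: Clark2015EuclideanOrderTypes, Example 2.6
and Thm. 27 (a)] -/
theorem Polynomial.iSup_samuelRank_pi {ι : Type u} [Fintype ι] [Nonempty ι] :
    (⨆ z : (ι → K[X]), (samuelRank z - 1 + 1)) = ω * (Fintype.card ι : Ordinal.{u}) :=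
  Pi.iSup_samuelRank_eq_omega0_mul_card (fun _ ↦ forall_exists_mem_samuelSet_of_euclideanDomain (R := K[X]))
    (fun _ ↦ Polynomial.iSup_samuelRank_eq_omega0)

/-- `e(k[t]ʳ) = ω·r` (`r ≥ 1`; `k` a field in `Type`, e.g. `ℚ`, `ℂ`, `𝔽_p`). [cite: Clark2015EuclideanOrderTypes, Example 2.6 and
Thm. 27 (a)] -/
theorem Polynomial.iSup_samuelRank_fin_pi {k : Type} [Field k] {r : ℕ} (hr : r ≠ 0) :
    (⨆ z : (Fin r → k[X]), (samuelRank z - 1 + 1)) = ω * (r : Ordinal.{0}) := by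
  haveI : Nonempty (Fin r) := ⟨⟨0, Nat.pos_of_ne_zero hr⟩⟩
  rw [Polynomial.iSup_samuelRank_pi, Fintype.card_fin]

end OrderType

/-! ## §2 `k[t]/(tⁿ)`: length `n`, Euclidean order type `n` -/

section Truncated

/-- `ℓ_{k[t]}(k[t]/(tⁿ)) = n`: `tⁿ` is the product of `n` primes `t` (Prop. 30 (b)). [cite: Clark2015EuclideanOrderTypes, Prop. 30 (b)
and proof of Thm. 27 (b)] -/
theorem Polynomial.length_quotient_span_X_pow (n : ℕ) :
    Module.length K[X] (K[X] ⧸ Ideal.span {(X : K[X]) ^ n}) = n := by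
  have h := length_quotient_span_unit_mul_multiset_prod (R := K[X]) (Multiset.replicate n (X : K[X]))
    (fun p hp ↦ by rw [Multiset.eq_of_mem_replicate hp]; exact Polynomial.prime_X) isUnit_one
  rwa [one_mul, Multiset.prod_replicate, Multiset.card_replicate] at h

/-- … and as a ring over itself, `ℓ(k[t]/(tⁿ)) = n` (its ideals are its `k[t]`-submodules). [cite: Clark2015EuclideanOrderTypes,
proof of Thm. 27 (b)] -/
theorem Polynomial.length_self_quotient_span_X_pow (n : ℕ) :
    Module.length (K[X] ⧸ Ideal.span {(X : K[X]) ^ n}) (K[X] ⧸ Ideal.span {(X : K[X]) ^ n}) = n := by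
  rw [← Module.length_eq_of_surjective (S := K[X]) (R := K[X] ⧸ Ideal.span {(X : K[X]) ^ n})
    (M := K[X] ⧸ Ideal.span {(X : K[X]) ^ n}) Ideal.Quotient.mk_surjective]
  exact Polynomial.length_quotient_span_X_pow n

/-- `k[t]/(tⁿ)` (`n ≥ 1`) is a non-zero Artinian principal ideal ring. [cite: Clark2015EuclideanOrderTypes, proof of Thm. 27 (b)] -/
theorem Polynomial.nontrivial_quotient_span_X_pow {n : ℕ} (hn : n ≠ 0) :
    Nontrivial (K[X] ⧸ Ideal.span {(X : K[X]) ^ n}) :=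
  Ideal.Quotient.nontrivial_iff.2 fun h ↦
    Polynomial.not_isUnit_X ((isUnit_pow_iff hn).1 (Ideal.span_singleton_eq_top.1 h))

/-- See `Polynomial.nontrivial_quotient_span_X_pow`. [cite: Clark2015EuclideanOrderTypes, proof of Thm. 27 (b)] -/
theorem Polynomial.isArtinianRing_quotient_span_X_pow {n : ℕ} (hn : n ≠ 0) :
    IsArtinianRing (K[X] ⧸ Ideal.span {(X : K[X]) ^ n}) := by
  rw [← Ideal.span_singleton_pow]
  exact isArtinianRing_quotient_pow (PrincipalIdealRing.isMaximal_of_irreducible Polynomial.irreducible_X) hn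

/-- **`e(k[t]/(tⁿ)) = n`** (`n ≥ 1`): `k[t]/(tⁿ)` is a non-zero Artinian principal ideal ring, so `e = ℓ = n` (Cor. 24).
[cite: Clark2015EuclideanOrderTypes, Cor. 24 and proof of Thm. 27 (b)] -/
theorem Polynomial.iSup_samuelRank_quotient_span_X_pow {n : ℕ} (hn : n ≠ 0) :
    (⨆ z : K[X] ⧸ Ideal.span {(X : K[X]) ^ n}, (samuelRank z - 1 + 1)) = (n : Ordinal.{u}) := by
  haveI := Polynomial.nontrivial_quotient_span_X_pow (K := K) hn
  haveI := Polynomial.isArtinianRing_quotient_span_X_pow (K := K) hn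
  haveI : IsPrincipalIdealRing (K[X] ⧸ Ideal.span {(X : K[X]) ^ n}) := isPrincipalIdealRing_quotient _
  obtain ⟨m, he, hl⟩ := exists_iSup_samuelRank_eq_and_length_eq (R := K[X] ⧸ Ideal.span {(X : K[X]) ^ n})
  rw [Polynomial.length_self_quotient_span_X_pow, Nat.cast_inj] at hl
  rw [he, hl]

/-- … and `k[t]/(tⁿ)` is Euclidean (exhausted by its transfinite construction). [cite: Clark2015EuclideanOrderTypes, Cor. 24] -/
theorem Polynomial.forall_exists_mem_samuelSet_quotient_span_X_pow {n : ℕ} (hn : n ≠ 0) :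
    ∀ z : K[X] ⧸ Ideal.span {(X : K[X]) ^ n}, ∃ α : Ordinal.{u}, z ∈ samuelSet (K[X] ⧸ Ideal.span {(X : K[X]) ^ n}) α := by
  haveI := Polynomial.isArtinianRing_quotient_span_X_pow (K := K) hn
  haveI : IsPrincipalIdealRing (K[X] ⧸ Ideal.span {(X : K[X]) ^ n}) := isPrincipalIdealRing_quotient _
  exact forall_exists_mem_samuelSet_of_isArtinianRing

end Truncated

/-! ## §3 Thm. 27 (b): `e(k[t]ʳ × k[t]/(tⁿ)) = ω·r + n` -/

section TheoremTwentySevenB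

/-- **Thm. 27 (b), Clark's witnesses: `e(k[t]^ι × k[t]/(tⁿ)) = ω·|ι| + n`** for a finite non-empty index type `ι`, `n ≥ 1` and any
field `k` («By part a), `e(ℂ[t]ʳ × ℂ[t]/(tⁿ)) = rω + n`»). [cite: Clark2015EuclideanOrderTypes, Thm. 27 (b)] -/
theorem Polynomial.iSup_samuelRank_pi_prod_quotient {ι : Type u} [Fintype ι] [Nonempty ι] {n : ℕ} (hn : n ≠ 0) :
    (⨆ z : (ι → K[X]) × (K[X] ⧸ Ideal.span {(X : K[X]) ^ n}), (samuelRank z - 1 + 1)) =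
      ω * (Fintype.card ι : Ordinal.{u}) + (n : Ordinal.{u}) := by
  haveI := Polynomial.nontrivial_quotient_span_X_pow (K := K) hn
  haveI := Polynomial.isArtinianRing_quotient_span_X_pow (K := K) hn
  haveI : IsPrincipalIdealRing (K[X] ⧸ Ideal.span {(X : K[X]) ^ n}) := isPrincipalIdealRing_quotient _
  rw [iSup_samuelRank_pi_prod_eq (fun _ ↦ forall_exists_mem_samuelSet_of_euclideanDomain (R := K[X]))
    (fun _ ↦ Polynomial.iSup_samuelRank_eq_omega0) (K[X] ⧸ Ideal.span {(X : K[X]) ^ n}),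
    Polynomial.length_self_quotient_span_X_pow, ENat.toNat_coe]

/-- **`e(k[t]ʳ × k[t]/(tⁿ)) = ω·r + n`** verbatim (`r, n ≥ 1`; `k` a field in `Type`, e.g. `ℂ`).
[cite: Clark2015EuclideanOrderTypes, Thm. 27 (b)] -/
theorem Polynomial.iSup_samuelRank_fin_pi_prod_quotient {k : Type} [Field k] {r : ℕ} (hr : r ≠ 0) {n : ℕ} (hn : n ≠ 0) :
    (⨆ z : (Fin r → k[X]) × (k[X] ⧸ Ideal.span {(X : k[X]) ^ n}), (samuelRank z - 1 + 1)) =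
      ω * (r : Ordinal.{0}) + (n : Ordinal.{0}) := by
  haveI : Nonempty (Fin r) := ⟨⟨0, Nat.pos_of_ne_zero hr⟩⟩
  rw [Polynomial.iSup_samuelRank_pi_prod_quotient hn, Fintype.card_fin]

/-- The ring `k[t]^ι × k[t]/(tⁿ)` is Euclidean (exhausted by its construction) — a genuine Euclidean ring of order type `ω·|ι| + n`.
[cite: Clark2015EuclideanOrderTypes, Thm. 27 (b) and Thm. 22 (a)] -/
theorem Polynomial.forall_exists_mem_samuelSet_pi_prod_quotient {ι : Type u} [Finite ι] {n : ℕ} (hn : n ≠ 0) :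
    ∀ z : (ι → K[X]) × (K[X] ⧸ Ideal.span {(X : K[X]) ^ n}),
      ∃ α : Ordinal.{u}, z ∈ samuelSet ((ι → K[X]) × (K[X] ⧸ Ideal.span {(X : K[X]) ^ n})) α :=
  Prod.forall_exists_mem_samuelSet
    (Pi.forall_exists_mem_samuelSet fun _ ↦ forall_exists_mem_samuelSet_of_euclideanDomain (R := K[X]))
    (Polynomial.forall_exists_mem_samuelSet_quotient_span_X_pow hn)

end TheoremTwentySevenB

end Literature.Algebra.EuclideanDomain
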